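import Literature.NumberTheory.Automorphic.Liu2021.AppendixC.RestOneLevelInvariantsHom
import HarnessLib

/-!
# Input (D) `IsogenyDescent` of the reduction of [Liu2021, Thm. 4.18 (1)] from an ALBANESE TRACE along the tower

[Liu2021] = Yifeng Liu, *Fourier–Jacobi cycles and arithmetic relative trace formula*, Camb. J. Math. **9** (2021) 1–147 =
arXiv:2102.11518 (`FJcycle.tex` line numbers as in `AppendixC/Glue.lean`).  PROOF FILE (theorems only; no definition, no named fact, no
instance, no `sorry`), sequel of `AppendixC/RestOneLevelInvariantsHom.lean`.

`Sec42Data.HeckeTranslates.IsogenyDescent T` («for sufficiently small levels `N ⊆ K` with `N` normalised by `K`, a homomorphism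
`φ : Alb(X_N) → B` fixed by every `Alb(T_k)`, `k ∈ K`, satisfies `Alb_{u^N_K} ≫ ψ = m·φ` for some `ψ : Alb(X_K) → B`, `m ≠ 0`») is the
homomorphism-level form of input (D) of the reduction (`levelDescent_of_isogenyDescent`).  Classically it comes from the ALBANESE TRACE of the
finite quotient `X_N → X_K = X_N/(K/N)` ([Lang1983AbelianVarieties] Ch. VIII §6, proof of Thm. 13: a homomorphism `t : Alb(X_K) → Alb(X_N)` with
`Alb_{u} ≫ t = Σ_{g ∈ K/N} Alb(T_g)`), followed by three lines of algebra (`Alb_u ≫ (t ≫ φ) = Σ_g Alb(T_g) ≫ φ = |K/N|·φ`).  This file is that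
algebra, stated on the §4.2 datum so that the geometric suppliers (the trace identity for the canonical-model tower) are consumed BY NAME:

* `Sec42Data.HeckeTranslates.isogenyDescent_of_trace` — if for all such `N ⊆ K` there are a finite non-empty index type `Δ`, homomorphisms
  `e_g : A_N → A_N` each equal to some `Alb(T_k)` (`k ∈ K`), and `t : A_K → A_N` with `Alb_{u^N_K} ≫ t = Σ_g e_g`, then `T.IsogenyDescent`
  (with `m = |Δ|`, `ψ = t ≫ φ`);
* `Sec42Data.HeckeTranslates.levelDescent_of_trace` — hence input (D) `T.LevelDescent`.

HC_CM is NOT proved; nothing here discharges a binder by itself (the trace identity is a hypothesis).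
References: [Liu2021] Thm. 4.18 (1) l. 2239, §4.2 l. 2062–2074; [Lang1983AbelianVarieties] Ch. VIII §6 Thm. 13 (proof).
-/

set_option autoImplicit false

noncomputable section

open CategoryTheory NumberField

namespace Literature.NumberTheory.Automorphic.Liu2021.AppendixC

namespace Sec42Data.HeckeTranslates

variable {F E : Type} [Field F] [NumberField F] [IsTotallyReal F] [Field E] [NumberField E] [Algebra F E]
  [IsTotallyComplex E] [Algebra.IsQuadraticExtension F E]
variable {P5 : PropC5Data F E} {isotropicAt : ℕ → Prop} {C : Sec42Data P5 isotropicAt} (T : C.HeckeTranslates)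

/-- **`IsogenyDescent` from an Albanese trace along the tower.**  Hypothesis (the geometric input, for every pair of sufficiently small
levels `N ⊆ K` with `N` normalised by `K`): a finite non-empty `Δ` (the quotient `K/N`), endomorphisms `e_g` of `A_N = Alb(X_N)` each of
which is a Hecke translate `Alb(T_k)`, `k ∈ K`, and a «trace» `t : A_K → A_N` with `Alb_{u^N_K} ≫ t = Σ_g e_g` ([Lang1983AbelianVarieties]
VIII §6: `f_* h_* = Σ_g g_*` for the Galois cover `X_N → X_K`).  Conclusion: every `φ : A_N → B` fixed by all `Alb(T_k)`, `k ∈ K`, has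
`Alb_{u^N_K} ≫ (t ≫ φ) = |Δ|·φ`, so `T.IsogenyDescent`. [cite: Lang1983AbelianVarieties, Ch. VIII §6 Thm. 13 (proof)]
[cite: Liu2021, Thm. 4.18 (1) FJcycle.tex l. 2239] -/
theorem isogenyDescent_of_trace
    (htr : ∀ ⦃N K : C5.SmallLevel C.S.K₀⦄ (h : N ≤ K) (hn : ∀ k ∈ K.1.1, C5.HeckeLE k N N),
      ∃ (Δ : Type) (_ : Fintype Δ) (_ : Nonempty Δ) (e : Δ → (C.A N ⟶ C.A N)) (t : C.A K ⟶ C.A N),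
        (∀ g : Δ, ∃ (k : C.G) (hk : k ∈ K.1.1), e g = T.albTr k N N (hn k hk)) ∧
          C.Atr (homOfLE h) ≫ t = ∑ g, e g) :
    T.IsogenyDescent := by
  intro N K h hn B φ hφ
  obtain ⟨Δ, _, _, e, t, he, ht⟩ := htr h hn
  have hφ' : ∀ g : Δ, e g ≫ φ = φ := by
    intro g
    obtain ⟨k, hk, hek⟩ := he g
    rw [hek]
    exact hφ k hk
  refine ⟨Fintype.card Δ, t ≫ φ, Int.natCast_ne_zero.2 Fintype.card_ne_zero, ?_⟩
  rw [← Category.assoc, ht, Preadditive.sum_comp]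
  simp_rw [hφ']
  rw [Finset.sum_const, Finset.card_univ, natCast_zsmul]

/-- **Input (D) `LevelDescent` from an Albanese trace along the tower** (`isogenyDescent_of_trace` followed by
`levelDescent_of_isogenyDescent`). [cite: Lang1983AbelianVarieties, Ch. VIII §6 Thm. 13 (proof)] [cite: Liu2021, Thm. 4.18 (1) FJcycle.tex l. 2239] -/
theorem levelDescent_of_trace
    (htr : ∀ ⦃N K : C5.SmallLevel C.S.K₀⦄ (h : N ≤ K) (hn : ∀ k ∈ K.1.1, C5.HeckeLE k N N),
      ∃ (Δ : Type) (_ : Fintype Δ) (_ : Nonempty Δ) (e : Δ → (C.A N ⟶ C.A N)) (t : C.A K ⟶ C.A N),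
        (∀ g : Δ, ∃ (k : C.G) (hk : k ∈ K.1.1), e g = T.albTr k N N (hn k hk)) ∧
          C.Atr (homOfLE h) ≫ t = ∑ g, e g) :
    T.LevelDescent :=
  T.levelDescent_of_isogenyDescent (T.isogenyDescent_of_trace htr)

end Sec42Data.HeckeTranslates

end Literature.NumberTheory.Automorphic.Liu2021.AppendixC

end
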